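import Literature.Algebra.Homology.OrderedCechSystemFullRing
import Literature.Algebra.Homology.OrderedCechSystemCup
import HarnessLib

/-!
# The restriction `res : F → Č_ord` is MULTIPLICATIVE: the position cup product restricts to the front∕back cup product
# of the ordered complex (The Stacks Project, Tag 01FP; Godement II §6.6)

Layer `Algebra/Homology`, PROOF lane (theorems only).  Joins F-F (`OrderedCechSystemFull`∕`…FullRing`, F0P1b-p01 (g0)) to F-C1
(`OrderedCechSystemCup`, F0P1b-p02 (g0)): for a natural pairing `μ` of systems and full cochains `x ∈ Fᵖ(M)`, `y ∈ Fᵠ(N)`,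

  `res (x ∪_F y) = cup μ p q n (res x) (res y)`      (`Full.res_cup`)

— the front∕back faces BY POSITION of the sorted enumeration `e_σ` of a simplex `σ` are the sorted enumerations of the cuts
`σ_{≤ e_σ(p)}`, `σ_{≥ e_σ(p)}` through its `p`-th vertex, and every other cut has the wrong number of vertices.  Hence
`H(res)` is a RING map for the two cup products; with `Full.res_ext` (`res ∘ ext = 𝟙`) it is a surjective one, and (T3)
(`AlgebraicGeometry/Modules/CechFullToOrdered`: `H(res)` injective in the geometric case) makes the ordered cup-product ring the
transport of the order-free one.  Cell `hodgecm-mathlib` FLOOR 0, P1 sub-line F-11, packet (iv)∕J3 (RULINGS #3 (R14)).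
No definition, no instance, no notation, no named fact.

## References
* The Stacks Project, Tag 01FP (cup product on Čech cochains), Tag 01FG. [StacksProject]
* R. Godement, *Topologie algébrique et théorie des faisceaux* (1958), II §6.6. [folklore]
* U. Görtz, T. Wedhorn, *Algebraic Geometry II* (2023), (21.29), Def. 21.68 (pp. 179–181). [GortzWedhorn2023]
-/

universe v u

open CategoryTheory

set_option backward.isDefEq.respectTransparency false -- `ModuleCat`-valued functors (as in ★ `OrderedCechSystem`)

noncomputable section

namespace Literature.Algebra.Homology

namespace OrderedCech

namespace Full

variable {ι : Type} [LinearOrder ι] {A : Type u} [CommRing A]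

/-! ## §1 The cuts through the `j`-th vertex of a simplex, by position -/

/-- The lower cut through the `j`-th vertex is the image of the first `j+1` positions. [cite: StacksProject, Tag 01FP] -/
theorem filter_le_orderEmbOfFin (s : Finset ι) {c : ℕ} (h : s.card = c) (j : Fin c) :
    s.filter (· ≤ s.orderEmbOfFin h j) = (Finset.Iic j).image (s.orderEmbOfFin h) := by
  ext x
  simp only [Finset.mem_filter, Finset.mem_image, Finset.mem_Iic]
  constructor
  · rintro ⟨hx, hle⟩
    have hx' : x ∈ Set.range (s.orderEmbOfFin h) := by rw [Finset.range_orderEmbOfFin]; exact hx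
    obtain ⟨i, rfl⟩ := hx'
    exact ⟨i, (s.orderEmbOfFin h).le_iff_le.mp hle, rfl⟩
  · rintro ⟨i, hi, rfl⟩
    exact ⟨Finset.orderEmbOfFin_mem s h i, (s.orderEmbOfFin h).le_iff_le.mpr hi⟩

/-- The upper cut through the `j`-th vertex is the image of the positions `≥ j`. [cite: StacksProject, Tag 01FP] -/
theorem filter_ge_orderEmbOfFin (s : Finset ι) {c : ℕ} (h : s.card = c) (j : Fin c) :
    s.filter (s.orderEmbOfFin h j ≤ ·) = (Finset.Ici j).image (s.orderEmbOfFin h) := by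
  ext x
  simp only [Finset.mem_filter, Finset.mem_image, Finset.mem_Ici]
  constructor
  · rintro ⟨hx, hle⟩
    have hx' : x ∈ Set.range (s.orderEmbOfFin h) := by rw [Finset.range_orderEmbOfFin]; exact hx
    obtain ⟨i, rfl⟩ := hx'
    exact ⟨i, (s.orderEmbOfFin h).le_iff_le.mp hle, rfl⟩
  · rintro ⟨i, hi, rfl⟩
    exact ⟨Finset.orderEmbOfFin_mem s h i, (s.orderEmbOfFin h).le_iff_le.mpr hi⟩

/-- The lower cut through the `j`-th vertex has `j + 1` vertices. [cite: StacksProject, Tag 01FP] -/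
theorem card_filter_le_orderEmbOfFin (s : Finset ι) {c : ℕ} (h : s.card = c + 1) (j : Fin (c + 1)) :
    (s.filter (· ≤ s.orderEmbOfFin h j)).card = (j : ℕ) + 1 := by
  rw [filter_le_orderEmbOfFin, Finset.card_image_of_injective _ (s.orderEmbOfFin h).injective, Fin.card_Iic]

/-- The upper cut through the `j`-th vertex has `c + 1 - j` vertices (`#s = c + 1`). [cite: StacksProject, Tag 01FP] -/
theorem card_filter_ge_orderEmbOfFin (s : Finset ι) {c : ℕ} (h : s.card = c + 1) (j : Fin (c + 1)) :
    (s.filter (s.orderEmbOfFin h j ≤ ·)).card = c + 1 - (j : ℕ) := by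
  rw [filter_ge_orderEmbOfFin, Finset.card_image_of_injective _ (s.orderEmbOfFin h).injective, Fin.card_Ici]

/-- The sorted enumeration of the lower cut through the `p`-th vertex of an `n`-simplex is the FRONT `p`-face of the
sorted enumeration (`p + q = n`). [cite: StacksProject, Tag 01FP] -/
theorem orderEmbOfFin_filter_le (s : Finset ι) {p q n : ℕ} (hpq : p + q = n) (h : s.card = n + 1)
    (h' : (s.filter (· ≤ s.orderEmbOfFin h ⟨p, by omega⟩)).card = p + 1) :
    ⇑((s.filter (· ≤ s.orderEmbOfFin h ⟨p, by omega⟩)).orderEmbOfFin h') = front p q n hpq ⇑(s.orderEmbOfFin h) := by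
  symm
  refine Finset.orderEmbOfFin_unique h' (fun i => ?_) ?_
  · rw [Finset.mem_filter, front_apply]
    exact ⟨Finset.orderEmbOfFin_mem s h _, (s.orderEmbOfFin h).le_iff_le.mpr (by
      change (⟨(i : ℕ), _⟩ : Fin (n + 1)) ≤ ⟨p, _⟩; rw [Fin.mk_le_mk]; omega)⟩
  · intro i i' hii'
    change s.orderEmbOfFin h ⟨i, _⟩ < s.orderEmbOfFin h ⟨i', _⟩
    exact (s.orderEmbOfFin h).strictMono (Fin.mk_lt_mk.mpr hii')

/-- The sorted enumeration of the upper cut through the `p`-th vertex of an `n`-simplex is the BACK `q`-face of the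
sorted enumeration (`p + q = n`). [cite: StacksProject, Tag 01FP] -/
theorem orderEmbOfFin_filter_ge (s : Finset ι) {p q n : ℕ} (hpq : p + q = n) (h : s.card = n + 1)
    (h' : (s.filter (s.orderEmbOfFin h ⟨p, by omega⟩ ≤ ·)).card = q + 1) :
    ⇑((s.filter (s.orderEmbOfFin h ⟨p, by omega⟩ ≤ ·)).orderEmbOfFin h') = back p q n hpq ⇑(s.orderEmbOfFin h) := by
  symm
  refine Finset.orderEmbOfFin_unique h' (fun i => ?_) ?_
  · rw [Finset.mem_filter, back_apply]
    exact ⟨Finset.orderEmbOfFin_mem s h _, (s.orderEmbOfFin h).le_iff_le.mpr (by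
      change (⟨p, _⟩ : Fin (n + 1)) ≤ ⟨p + (i : ℕ), _⟩; rw [Fin.mk_le_mk]; omega)⟩
  · intro i i' hii'
    change s.orderEmbOfFin h ⟨p + i, _⟩ < s.orderEmbOfFin h ⟨p + i', _⟩
    exact (s.orderEmbOfFin h).strictMono (Fin.mk_lt_mk.mpr (by
      have : (i : ℕ) < i' := hii'; omega))

/-! ## §2 `res` is multiplicative -/

variable {M N P : Finset ι ⥤ ModuleCat.{v} A} (μ : ∀ s : Finset ι, M.obj s →ₗ[A] N.obj s →ₗ[A] P.obj s)

/-- **The restriction `res : F → Č_ord` is multiplicative**: for a natural pairing `μ` and `p + q = n`,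
`res (x ∪_F y) = cup μ p q n (res x) (res y)` — the position cup of the full complex restricts to the front∕back cup of
the ordered complex (F-C1, `OrderedCech.cup`). [cite: StacksProject, Tag 01FP] [cite: GortzWedhorn2023, (21.29)] -/
theorem res_cup (hμ : IsNaturalPairing μ) {p q n : ℕ} (h : p + q = n) (x : Cochain M p) (y : Cochain N q) :
    res P n (cup μ p q n h x y) =
      OrderedCech.cup μ (p : ℤ) (q : ℤ) (n : ℤ) (res M p x) (res N q y) := by
  classical
  funext σ
  have hc : σ.1.card = n + 1 := card_simplex n σ
  rw [res_apply, cup_apply, hμ, map_map_apply, map_map_apply, OrderedCech.cup_apply,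
    sum_eq_sum_orderEmbOfFin σ.1 hc]
  -- only the `p`-th vertex contributes
  rw [Finset.sum_eq_single (⟨p, by omega⟩ : Fin (n + 1))]
  rotate_left
  · intro j _ hj
    have hcard : ((σ.1.filter (· ≤ σ.1.orderEmbOfFin hc j)).card : ℤ) ≠ (p : ℤ) + 1 := by
      rw [card_filter_le_orderEmbOfFin]
      have : (j : ℕ) ≠ p := fun hh => hj (Fin.ext hh)
      push_cast
      omega
    rw [ext0At_lowerCut_eq_zero _ _ _ _ hcard, map_zero, LinearMap.zero_apply]
  · intro hp; exact absurd (Finset.mem_univ _) hp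
  -- the `p`-th vertex: the cuts are the front and back faces
  have h₁ : (σ.1.filter (· ≤ σ.1.orderEmbOfFin hc ⟨p, by omega⟩)).card = p + 1 :=
    card_filter_le_orderEmbOfFin σ.1 hc _
  have h₂ : (σ.1.filter (σ.1.orderEmbOfFin hc ⟨p, by omega⟩ ≤ ·)).card = q + 1 := by
    rw [card_filter_ge_orderEmbOfFin σ.1 hc]; simp only; omega
  have hs₁ : (σ.1.filter (· ≤ σ.1.orderEmbOfFin hc ⟨p, by omega⟩)).Nonempty ∧
      ((σ.1.filter (· ≤ σ.1.orderEmbOfFin hc ⟨p, by omega⟩)).card : ℤ) = (p : ℤ) + 1 :=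
    ⟨Finset.card_pos.mp (by omega), by exact_mod_cast h₁⟩
  have hs₂ : (σ.1.filter (σ.1.orderEmbOfFin hc ⟨p, by omega⟩ ≤ ·)).Nonempty ∧
      ((σ.1.filter (σ.1.orderEmbOfFin hc ⟨p, by omega⟩ ≤ ·)).card : ℤ) = (q : ℤ) + 1 :=
    ⟨Finset.card_pos.mp (by omega), by exact_mod_cast h₂⟩
  rw [SysCochain.ext0At_val (res M p x) ⟨_, hs₁⟩ σ.1 (lowerCut_subset _ _),
    SysCochain.ext0At_val (res N q y) ⟨_, hs₂⟩ σ.1 (upperCut_subset _ _), res_apply, res_apply,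
    map_map_apply, map_map_apply]
  exact term_congr μ x y (orderEmbOfFin_filter_le σ.1 h hc (card_simplex p ⟨_, hs₁⟩)).symm
    (orderEmbOfFin_filter_ge σ.1 h hc (card_simplex q ⟨_, hs₂⟩)).symm _ _ _ _

end Full

end OrderedCech

end Literature.Algebra.Homology

end
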